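import Literature.NumberTheory.EllipticCurves.BurungaleCastellaSkinner2025.GreenbergMuInvariantProofs
import HarnessLib

/-!
# Burungale–Castella–Skinner 2025, Proposition 4.2.2 — the `L_p^Gr` half at a prime of GOOD
# (not necessarily ordinary) reduction: NAMED FACT (reduction-type-free) and its by-name ports

Typing layer (role `literature-prover`, cite item `wi-79492` of family `bsd-wall-ss`). Companion of
`BDPMainConjecture.lean` (the `L_p^BDP` half, named fact `prop422_exists_isBDPLFunction_mu_eq_zero`,
ALREADY reduction-type-free: hypothesis `W.HasGoodReductionAtPrime p`) and of
`GreenbergMuInvariantProofs.lean` (the `L_p^Gr` half PROVED, but only under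
`YanZhu2026.GreenbergSetting`, whose field `goodOrd` is good ORDINARY reduction).

A. Burungale, F. Castella, C. Skinner, *Base change and Iwasawa main conjectures for GL₂*, IMRN 2025
rnaf082 = arXiv:2405.00270v2, **Proposition 4.2.2** (§4.2, p. 9; held text
`paper:arxiv-2405.00270 p0009.txt:L2–L13`), verbatim:

> **Proposition 4.2.2.** Let `g ∈ S₂(Γ₀(N))` be an elliptic newform with good reduction at `p > 2`,
> and suppose `K` is an imaginary quadratic field satisfying (disc), (Heeg), (spl), and (irr_K).
> Then `μ(L_p^Gr(g/K)) = μ(L_p^BDP(g/K)) = 0`.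
> *Proof.* By [Hsi14, Thm. B], `L_p^BDP(g/K)` has vanishing `μ`-invariant. Since a direct comparison
> of the interpolation properties shows that the projection of `L_p^Gr(g/K)` to `Λ_K^{−,ur}`
> generates the same ideal as `L_p^BDP(g/K)` (see [CGS23, Prop. 1.4.5]), the result follows. □

Here `L_p^Gr(g/K) ∈ Λ_K^{ur}` is the two-variable Greenberg/Rankin–Selberg `p`-adic `L`-function of
§4.1 (Conj. 4.1.2 there is stated for "`p > 2` a prime of good reduction for `g`", p0008.txt:L14–16),
constructed against the (ordinary) Katz CM family with `g` of fixed weight `2` — no ordinarity of `g`;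
the tree's value frame for it is the reduction-type-free `IsGreenbergLFunctionAnyRoot₂`
(`BurungaleSkinnerTianWan2024/GreenbergMainStatementOPEN.lean`: "the value is demanded at EVERY
complex root `α` of `x² − a_p(f)x + p` … at a supersingular `p` there is no unit root").

* `prop422_grHalf_hasUnitContent_minus` — NAMED FACT (`def … : Prop`, never asserted): the
  statement PROVED in `GreenbergMuInvariantProofs.lean` under `GreenbergSetting`
  (`hasUnitContent_minus_of_prop314AnyRoot_of_prop422`), with the structure's fields spelled out as
  hypotheses and `goodOrd : GoodOrd W p` REPLACED by `W.HasGoodReductionAtPrime p`, `3 ≤ p` by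
  `2 < p` — i.e. exactly the hypotheses BCS print for Prop. 4.2.2 (the frame binders, the embedding
  compatibility of `𝔭` with `ι`, `N = N_E`, `(N, D_K) = 1` and the adapted generator pair are the
  tree's standing conventions for every Katz/Greenberg fact; `(N, D_K) = 1` follows from (Heeg)).
  Conclusion, as in the ordinary-case theorem: for EVERY Katz frame `LK` and EVERY `G` in
  `IsGreenbergLFunctionAnyRoot₂ … LK G`, `HasUnitContent (minus G)` — some coefficient `[T₁⁰T₂ʲ] G`
  is a unit of `𝒪_{ℂ_p}`, i.e. `μ` of the anticyclotomic projection `G⁻` vanishes. This is what the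
  printed proof yields (the projection generates `(L_p^BDP)`, which has `μ = 0`), and it implies the
  headline `μ(L_p^Gr) = 0` (`exists_isUnit_coeff_coeff_of_prop422GrHalf`). Typed for `g = f_E`
  (an elliptic newform IS the newform of an elliptic curve; `W` globally minimal).
  FAITHFUL to print on the reduction type; STRONGER-than-headline / EQUAL-to-proof on the conclusion
  (minus-line form); frame `∀`-quantified (uniqueness of a bounded measure with the full interpolation
  property). PUBLISHED (IMRN 2025; sources [Hsi14, Thm. B], [CGS23, Prop. 1.4.5]).
  -- TODO(general form): `g` a weight-two newform with arbitrary Hecke field.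
* `hasUnitContent_minus_of_prop422GrHalf` — by-name port (users take `(h : prop422_grHalf_…)`).
* `exists_isUnit_coeff_coeff_of_prop422GrHalf` — the headline `μ(L_p^Gr(E/K)) = 0` in the
  two-variable sense from the fact.
* `hasUnitContent_minus_of_prop422GrHalf_of_greenbergSetting` — consistency: under
  `GreenbergSetting` (good ordinary) the fact gives back the conclusion of the PROVED ordinary theorem
  `hasUnitContent_minus_of_prop314AnyRoot_of_prop422` (same binders), so consumers can switch by name.

WHY (requester, planner `bsd-wall-ss`, note D2-NOTE-v1.md): route SignedBaseChange's crux K2R‴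
(stmt-BirchSwinnertonDyer-20213) needs `μ(L_p^Gr⁻) = 0` at a SUPERSINGULAR prime to cancel the
cyclotomic slack of K1 via the tree's `le_span_of_span_map_C_mul_le_of_hasUnitContent_minus` and
`hasUnitContent_minus_mul`; the tree had the statement only at good ordinary `p`.

Honest framing: a refereed proposition typed as a named fact with its printed hypotheses; typed ≠
proved ≠ endorsed; nothing here bears on BSD beyond supplying a by-name input; orientation caveat
CGS-241 of the sibling files concerns the ideal comparison, not unit content.

## References
* [BurungaleCastellaSkinner2025] IMRN 2025 rnaf082 = arXiv:2405.00270v2, §4.1 Conj. 4.1.2 (p. 8),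
  §4.2 Prop. 4.2.2 and its proof (p. 9; held text paper:arxiv-2405.00270 p0009.txt:L2–L13).
* [Hsieh2014] M.-L. Hsieh, Doc. Math. 19 (2014), Thm. B (source of `μ(L_p^BDP) = 0`).
* [CastellaGrossiSkinner2025] F. Castella, G. Grossi, C. Skinner, Prop. 2.4.5 (= CGS23 Prop. 1.4.5:
  the projection of `L_p^Gr` generates `(L_p^BDP)`); §2.4 (the construction of `L_p^Gr`).
* [YanZhu2024MainConjNonCM] Def. 3.11 / Prop. 3.14 (the tree's Greenberg frame and comparison).

## v2 (literature-prover `hubbard-fast-lit-g21`, cite item `wi-79486` — the twin of `wi-79492`, same day): LOCATED DEFECT and the GUARDED fact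

LOCATED DEFECT (PROVED below, §Z): the two frame predicates are pure `∀`-interpolation predicates and
ADMIT A DEGENERATE MEMBER. With the period `Ω = 0` every prescribed Katz value
`Ω^{−(m+j)} · … · Ω_p^{m+j}` is `0` (`m + j ≥ 1` on the Katz range, Lean's `0⁻¹ = 0`), so the zero
series IS a Katz frame: `isKatzMeasure₂_zero_of_period_eq_zero`; over the Katz series `LK = 0` the zero
series IS a Greenberg frame (the prescribed value `h_K · y · (…)` has `y = 0`):
`isGreenbergLFunctionAnyRoot₂_zero_zero`; and `minus 0 = 0` has no unit coefficient
(`not_hasUnitContent_minus_zero`). CONSEQUENCE: the v1 fact `prop422_grHalf_hasUnitContent_minus`,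
whose frame binders `∀ (Ω δ : ℂ) (Ωp) (LK G), IsKatzMeasure₂ … Ω δ Ωp LK → IsGreenbergLFunctionAnyRoot₂ …
LK G → …` carry NO `Ω ≠ 0`, is CONTRADICTED at `(Ω, LK, G) = (0, 0, 0)` on every instance of its
curve/field/tower hypotheses — `prop422_grHalf_hasUnitContent_minus.false_of_instance` (PROVED: from
`h : prop422_grHalf_…` and any data satisfying the printed hypotheses, `False`). A route taking
`(h : prop422_grHalf_hasUnitContent_minus)` would therefore be arguing from a hypothesis that refutes
its own setting. (The tree cannot BUILD an instance — `IsNewformOf W f` etc. are not constructible —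
so no closed `False` is derivable; the fact is nonetheless mis-stated: in print `Ω = Ω_∞ ∈ ℂˣ` is a CM
period, de Shalit II.4.12, and the statement is meant for Katz's measure, not for `0`.) The same
omission affects other `∀`-over-frames facts typed without the period binders (e.g.
`YanZhu2026.prop314_span_minus_eq_span_bdp[_anyRoot]`, `thm47_ord_localised_iff_greenberg[AnyRoot]_localised`,
`BurungaleCastellaSkinner2025.cor414_…`, `thm413_…`), whereas the BSTW-typed ones
(`thm924_…_OPEN`, `thm1010b_…_OPEN`) and every route binder of `SignedBaseChange` carry
`Ω ≠ 0 → (δ² = D_K ∨ δ² = −D_K) →`; reported to the typing cell (ledger work item), not repaired here.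

THE GUARDED FACT `prop422_greenbergAnyRoot_hasUnitContent_minus` (§B′): VERBATIM the v1 statement with
the two period binders `Ω ≠ 0 →` and `(δ² = D_K ∨ δ² = −D_K) →` inserted before the Katz frame — the
conjuncts that every frame-SUPPLYING `∃`-fact of the tree delivers
(`YanZhu2026.thm39_def311_exists_isGreenbergLFunctionAnyRoot₂`, `thm42_…AnyRoot`,
`BurungaleSkinnerTianWan2024.thm617_exists_isGreenbergLFunctionAnyRoot₂_supersingular_PRE`, the route's
`GreenbergFramesAtSupersingular`), so no consumer loses anything; the v1 fact implies it
(`prop422_greenbergAnyRoot_hasUnitContent_minus.of_grHalf`, PROVED — the guarded fact is WEAKER). With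
`Ω ≠ 0` the degenerate member is gone: a rescaling `Ω ↦ cΩ` of genuine period data changes the
prescribed values by `ι⁻¹(c)^{−(m+j)}`, which is interpolable by an integral series only when `ι⁻¹(c)`
is a principal unit, and then by a UNIT of `𝒪_{ℂ_p}⟦T₁⟧⟦T₂⟧` — unit content of `G⁻` is unchanged; so
the guarded `∀`-statement says exactly what the printed proof shows about print's `L_p^Gr(g/K)`.
Consumers: take `(h : prop422_greenbergAnyRoot_hasUnitContent_minus)`; ports
`exists_isUnit_coeff_coeff_of_prop422GrAnyRoot` (the headline `μ(L_p^Gr) = 0`),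
`hasUnitContent_minus_of_prop422GrAnyRoot_of_greenbergSetting` (ordinary special case, the currency of
`GreenbergMuInvariantProofs.lean`), `prop422_both_goodReduction_of_frame` (both halves, given any frame
supplier). ORIENTATION-ROBUST: unit content of `G⁻` is invariant under `T ↦ (1+T)⁻¹ − 1` (an
automorphism of `𝒪_{ℂ_p}⟦T⟧` reducing to one of `k⟦T⟧`; `HasUnitContent` = "reduction mod `𝔪` ≠ 0",
`hasUnitContent_iff_map_residue_ne_zero`), so the flag `CGS-241-orientation` does not bear on it.
D-0026 (v2): ONE new named fact (the guarded re-vendoring of a mis-stated one); 9 theorems PROVED; the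
v1 declarations are kept verbatim (statement of the v1 def unchanged; its docstring gains a STATUS line).

## References (v2)
* [BurungaleCastellaSkinner2025] arXiv:2405.00270v2: Prop. 4.2.2 and proof (p. 9 L2–L13), Conj. 4.1.2
  (p. 8 L15–L19), §1.2 (disc)/(Heeg)/(spl) (p. 2 L34–L39), §4 (irr_K) and the pointer to
  [CGS23, §§1.2, 1.4] for `L_p^Gr` (p. 7 L52–L59).
* [deShalit1987] II.4.12 (Ω, Ω_p the period pair, Ω ∈ ℂˣ), II.4.16 (49)–(50), II.4.17 (54) — the frame
  `IsKatzMeasure₂` and `DeShalit1987.interpolationValue` (`Rubin1991/TwoVariableMainConjecture.lean`,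
  `DeShalit1987/KatzPAdicLFunction.lean`).
* [GreenbergVatsal2000] p. 2 (1)–(2) (`μ = 0` ⟺ a unit coefficient).
-/

noncomputable section

open scoped Classical

open PowerSeries NumberField IsDedekindDomain Field CongruenceSubgroup
  Literature.NumberTheory.GaloisRepresentations Literature.NumberTheory.EllipticCurves
  Literature.NumberTheory.EllipticCurves.ModularForms Literature.NumberTheory.EllipticCurves.Rank1Residual
  Literature.NumberTheory.EllipticCurves.GreenbergVatsal2000
  Literature.NumberTheory.EllipticCurves.UnrSeries₂

namespace Literature.NumberTheory.EllipticCurves.BurungaleCastellaSkinner2025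

open YanZhu2026

/-- STATUS (v2, located 2026-08-27, module docstring §v2): MIS-STATED as a `∀`-statement over frames —
WITHOUT the period binder `Ω ≠ 0` the degenerate frame `(Ω, LK, G) = (0, 0, 0)` satisfies both frame
predicates (`isKatzMeasure₂_zero_of_period_eq_zero`, `isGreenbergLFunctionAnyRoot₂_zero_zero`, PROVED)
and `minus 0` has no unit coefficient, so this Prop is contradicted on every instance of its own
hypotheses (`prop422_grHalf_hasUnitContent_minus.false_of_instance`, PROVED). DO NOT take it as a route
hypothesis; take `(h : prop422_greenbergAnyRoot_hasUnitContent_minus)` (§B′ below: the same statement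
with `Ω ≠ 0 → (δ² = ±D_K) →`, which every frame-supplying fact delivers). Statement kept verbatim
(never edited in place). ORIGINAL DOCSTRING: NAMED FACT — **Burungale–Castella–Skinner 2025, Prop. 4.2.2, the `L_p^Gr` half, at a prime of
GOOD reduction `p > 2` (minus line)**: "Let `g ∈ S₂(Γ₀(N))` be an elliptic newform with good
reduction at `p > 2`, and suppose `K` is an imaginary quadratic field satisfying (disc), (Heeg), (spl),
and (irr_K). Then `μ(L_p^Gr(g/K)) = μ(L_p^BDP(g/K)) = 0`." Transcribed for `g = f_E` (`W/ℚ` elliptic,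
globally minimal, newform `f` of level `N = N_E`), `2 < p`, `W.HasGoodReductionAtPrime p` (NOT
necessarily ordinary), `K` imaginary quadratic with (Heeg), (spl) `p𝒪_K = 𝔭𝔭̄` (`𝔭 ≠ 𝔭̄` above `p`,
`𝔭` the prime of `ι`), (disc) `D_K` odd `≠ −3`, `(N, D_K) = 1`, (irr_K), `(κ₁, κ₂)` = (cyclotomic,
anticyclotomic) with an adapted top-generator pair `(γ₁, γ₂)`: EVERY Katz frame `LK` (at
`(γ₁⁻¹, γ₂⁻¹)`) and EVERY `G` with `IsGreenbergLFunctionAnyRoot₂ ι 𝔭 𝔭̄ κ₁ κ₂ γ₁⁻¹ γ₂⁻¹ f |D_K| h_K LK G`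
has `HasUnitContent (minus G)` — some coefficient `[T₁⁰ T₂ʲ] G` is a unit of `𝒪_{ℂ_p}` (`μ` of the
anticyclotomic projection vanishes; this is what the printed proof shows and it implies the headline,
`exists_isUnit_coeff_coeff_of_prop422GrHalf`). The same statement with GOOD ORDINARY reduction
(`GreenbergSetting`) is the THEOREM `hasUnitContent_minus_of_prop314AnyRoot_of_prop422`. Users take
`(h : prop422_grHalf_hasUnitContent_minus)`. FAITHFUL on the reduction type; minus-line conclusion =
EQUAL-to-proof, STRONGER-than-headline; frame `∀`-quantified; PUBLISHED.
-- TODO(general form): `g` a weight-two newform with arbitrary Hecke field.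
[cite: BurungaleCastellaSkinner2025, Prop. 4.2.2 and its proof (§4.2, p. 9 of arXiv:2405.00270v2; held text p0009.txt:L2–L13)]
[cite: Hsieh2014, Thm. B (the source of `μ(L_p^BDP) = 0`, as cited by BCS)]
[cite: CastellaGrossiSkinner2025, Prop. 2.4.5 (= CGS23 Prop. 1.4.5, the ideal comparison cited by BCS)] -/
def prop422_grHalf_hasUnitContent_minus : Prop :=
  ∀ {p : ℕ} [Fact p.Prime] (ι : PadicAlgCl p ≃+* ℂ) (W : WeierstrassCurve ℚ) [W.IsElliptic]
    [W.IsGloballyMinimal] (K : Type) [Field K] [NumberField K] (v vbar : HeightOneSpectrum (𝓞 K))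
    (κ₁ κ₂ : ZpExtension K p) (γ₁ γ₂ : Field.absoluteGaloisGroup K)
    [Fact (ZpExtension.IsTopGeneratorPair κ₁ κ₂ γ₁ γ₂)] {N : ℕ} [NeZero N]
    {f : CuspForm (Gamma0 N) 2} (_ : IsNewformOf W f) [NeZero (NumberField.discr K).natAbs],
    (N : ℤ) = W.conductorNorm ℤ → 2 < p → W.HasGoodReductionAtPrime p →
    IsImaginaryQuadratic K → SatisfiesHeegnerHypothesis N K →
    ((Ideal.span {(p : ℤ)}).primesOver (𝓞 K)).ncard = 2 →
    Odd (NumberField.discr K) → NumberField.discr K ≠ -3 → IsCoprime (N : ℤ) (NumberField.discr K) →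
    (W.baseChange K).HasIrreducibleModPGaloisRep p →
    ((p : ℕ) : 𝓞 K) ∈ v.asIdeal → ((p : ℕ) : 𝓞 K) ∈ vbar.asIdeal → vbar ≠ v →
    (∀ (w : InfinitePlace K) (k : 𝓞 K), k ∈ v.asIdeal ↔ ‖ι.symm (w.embedding (k : K))‖ < 1) →
    κ₁.IsCyclotomic → κ₂.IsAnticyclotomic →
    ∀ (Ω δ : ℂ) (Ωp : (unrIntegers p)ˣ) (LK G : PowerSeries (PowerSeries (PadicComplexInt p))),
      IsKatzMeasure₂ ι v vbar ∅ κ₁ κ₂ γ₁⁻¹ γ₂⁻¹ 1 Ω δ ((Ωp : unrIntegers p) : ℂ_[p]) LK →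
      IsGreenbergLFunctionAnyRoot₂ ι v vbar κ₁ κ₂ γ₁⁻¹ γ₂⁻¹ f (NumberField.discr K).natAbs
        (NumberField.classNumber K) LK G →
      HasUnitContent (minus G)

variable {p : ℕ} [Fact p.Prime]

/-- **By-name port of the fact** (explicit binders, reduction-type-free): under BCS's printed
hypotheses at a prime of good reduction `p > 2`, every Greenberg frame has `μ(G⁻) = 0`.
[cite: BurungaleCastellaSkinner2025, Prop. 4.2.2 (§4.2, p. 9 of arXiv:2405.00270v2)] -/
theorem hasUnitContent_minus_of_prop422GrHalf (h : prop422_grHalf_hasUnitContent_minus)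
    (ι : PadicAlgCl p ≃+* ℂ) (W : WeierstrassCurve ℚ) [W.IsElliptic] [W.IsGloballyMinimal] (K : Type)
    [Field K] [NumberField K] (v vbar : HeightOneSpectrum (𝓞 K)) (κ₁ κ₂ : ZpExtension K p)
    (γ₁ γ₂ : absoluteGaloisGroup K) [Fact (ZpExtension.IsTopGeneratorPair κ₁ κ₂ γ₁ γ₂)]
    {N : ℕ} [NeZero N] {f : CuspForm (Gamma0 N) 2} (hf : IsNewformOf W f)
    [NeZero (NumberField.discr K).natAbs]
    (hN : (N : ℤ) = W.conductorNorm ℤ) (hp : 2 < p) (hgood : W.HasGoodReductionAtPrime p)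
    (hK : IsImaginaryQuadratic K) (hHeeg : SatisfiesHeegnerHypothesis N K)
    (hspl : ((Ideal.span {(p : ℤ)}).primesOver (𝓞 K)).ncard = 2)
    (hodd : Odd (NumberField.discr K)) (hne3 : NumberField.discr K ≠ -3)
    (hcop : IsCoprime (N : ℤ) (NumberField.discr K))
    (hirrK : (W.baseChange K).HasIrreducibleModPGaloisRep p)
    (hv : ((p : ℕ) : 𝓞 K) ∈ v.asIdeal) (hvbar : ((p : ℕ) : 𝓞 K) ∈ vbar.asIdeal) (hne : vbar ≠ v)
    (hcompat : ∀ (w : InfinitePlace K) (k : 𝓞 K), k ∈ v.asIdeal ↔ ‖ι.symm (w.embedding (k : K))‖ < 1)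
    (hcyc : κ₁.IsCyclotomic) (hanti : κ₂.IsAnticyclotomic)
    {Ω δ : ℂ} {Ωp : (unrIntegers p)ˣ} {LK G : PowerSeries (PowerSeries (PadicComplexInt p))}
    (hLK : IsKatzMeasure₂ ι v vbar ∅ κ₁ κ₂ γ₁⁻¹ γ₂⁻¹ 1 Ω δ ((Ωp : unrIntegers p) : ℂ_[p]) LK)
    (hG : IsGreenbergLFunctionAnyRoot₂ ι v vbar κ₁ κ₂ γ₁⁻¹ γ₂⁻¹ f (NumberField.discr K).natAbs
      (NumberField.classNumber K) LK G) :
    HasUnitContent (minus G) :=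
  h ι W K v vbar κ₁ κ₂ γ₁ γ₂ hf hN hp hgood hK hHeeg hspl hodd hne3 hcop hirrK hv hvbar hne hcompat hcyc
    hanti Ω δ Ωp LK G hLK hG

/-- **The headline `μ(L_p^Gr(E/K)) = 0` in the two-variable sense** at a prime of good reduction,
granted the fact: some coefficient `[T₁⁰ T₂ʲ] G` of the Greenberg series is a unit of `𝒪_{ℂ_p}`.
[cite: BurungaleCastellaSkinner2025, Prop. 4.2.2 (§4.2, p. 9 of arXiv:2405.00270v2)] -/
theorem exists_isUnit_coeff_coeff_of_prop422GrHalf (h : prop422_grHalf_hasUnitContent_minus)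
    (ι : PadicAlgCl p ≃+* ℂ) (W : WeierstrassCurve ℚ) [W.IsElliptic] [W.IsGloballyMinimal] (K : Type)
    [Field K] [NumberField K] (v vbar : HeightOneSpectrum (𝓞 K)) (κ₁ κ₂ : ZpExtension K p)
    (γ₁ γ₂ : absoluteGaloisGroup K) [Fact (ZpExtension.IsTopGeneratorPair κ₁ κ₂ γ₁ γ₂)]
    {N : ℕ} [NeZero N] {f : CuspForm (Gamma0 N) 2} (hf : IsNewformOf W f)
    [NeZero (NumberField.discr K).natAbs]
    (hN : (N : ℤ) = W.conductorNorm ℤ) (hp : 2 < p) (hgood : W.HasGoodReductionAtPrime p)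
    (hK : IsImaginaryQuadratic K) (hHeeg : SatisfiesHeegnerHypothesis N K)
    (hspl : ((Ideal.span {(p : ℤ)}).primesOver (𝓞 K)).ncard = 2)
    (hodd : Odd (NumberField.discr K)) (hne3 : NumberField.discr K ≠ -3)
    (hcop : IsCoprime (N : ℤ) (NumberField.discr K))
    (hirrK : (W.baseChange K).HasIrreducibleModPGaloisRep p)
    (hv : ((p : ℕ) : 𝓞 K) ∈ v.asIdeal) (hvbar : ((p : ℕ) : 𝓞 K) ∈ vbar.asIdeal) (hne : vbar ≠ v)
    (hcompat : ∀ (w : InfinitePlace K) (k : 𝓞 K), k ∈ v.asIdeal ↔ ‖ι.symm (w.embedding (k : K))‖ < 1)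
    (hcyc : κ₁.IsCyclotomic) (hanti : κ₂.IsAnticyclotomic)
    {Ω δ : ℂ} {Ωp : (unrIntegers p)ˣ} {LK G : PowerSeries (PowerSeries (PadicComplexInt p))}
    (hLK : IsKatzMeasure₂ ι v vbar ∅ κ₁ κ₂ γ₁⁻¹ γ₂⁻¹ 1 Ω δ ((Ωp : unrIntegers p) : ℂ_[p]) LK)
    (hG : IsGreenbergLFunctionAnyRoot₂ ι v vbar κ₁ κ₂ γ₁⁻¹ γ₂⁻¹ f (NumberField.discr K).natAbs
      (NumberField.classNumber K) LK G) :
    ∃ j : ℕ, IsUnit (PowerSeries.coeff j (PowerSeries.coeff 0 G)) := by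
  obtain ⟨j, hj⟩ := hasUnitContent_minus_of_prop422GrHalf h ι W K v vbar κ₁ κ₂ γ₁ γ₂ hf hN hp hgood hK
    hHeeg hspl hodd hne3 hcop hirrK hv hvbar hne hcompat hcyc hanti hLK hG
  exact ⟨j, by rwa [coeff_minus] at hj⟩

/-- **Consistency with the ordinary case**: under `GreenbergSetting` (good ORDINARY `p ≥ 3`) the fact
returns the conclusion of the PROVED theorem `hasUnitContent_minus_of_prop314AnyRoot_of_prop422`, with
the same binders — consumers may switch by name (`GoodOrd W p` gives good reduction by `.1`).
[cite: BurungaleCastellaSkinner2025, Prop. 4.2.2 (§4.2, p. 9 of arXiv:2405.00270v2)]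
[cite: YanZhu2024MainConjNonCM, §4.1 setting (arXiv:2412.20078v4 TeX l.909–915)] -/
theorem hasUnitContent_minus_of_prop422GrHalf_of_greenbergSetting (h : prop422_grHalf_hasUnitContent_minus)
    (ι : PadicAlgCl p ≃+* ℂ) (W : WeierstrassCurve ℚ) [W.IsElliptic] [W.IsGloballyMinimal] (K : Type)
    [Field K] [NumberField K] (v vbar : HeightOneSpectrum (𝓞 K)) (κ₁ κ₂ : ZpExtension K p)
    (γ₁ γ₂ : absoluteGaloisGroup K) [Fact (ZpExtension.IsTopGeneratorPair κ₁ κ₂ γ₁ γ₂)]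
    {N : ℕ} [NeZero N] {f : CuspForm (Gamma0 N) 2} (hf : IsNewformOf W f)
    [NeZero (NumberField.discr K).natAbs] (hS : GreenbergSetting ι W N K v vbar κ₁ κ₂)
    (hHeeg : SatisfiesHeegnerHypothesis N K) (hirrK : (W.baseChange K).HasIrreducibleModPGaloisRep p)
    {Ω δ : ℂ} {Ωp : (unrIntegers p)ˣ} {LK G : PowerSeries (PowerSeries (PadicComplexInt p))}
    (hLK : IsKatzMeasure₂ ι v vbar ∅ κ₁ κ₂ γ₁⁻¹ γ₂⁻¹ 1 Ω δ ((Ωp : unrIntegers p) : ℂ_[p]) LK)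
    (hG : IsGreenbergLFunctionAnyRoot₂ ι v vbar κ₁ κ₂ γ₁⁻¹ γ₂⁻¹ f (NumberField.discr K).natAbs
      (NumberField.classNumber K) LK G) :
    HasUnitContent (minus G) :=
  hasUnitContent_minus_of_prop422GrHalf h ι W K v vbar κ₁ κ₂ γ₁ γ₂ hf hS.level
    (by have := hS.three_le; omega) hS.goodOrd.1 hS.isImaginaryQuadratic hHeeg hS.split hS.discr_odd
    hS.discr_ne hS.coprime hirrK hS.mem_v hS.mem_vbar hS.vbar_ne hS.compat hS.cyclotomic hS.anticyclotomic
    hLK hG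

end Literature.NumberTheory.EllipticCurves.BurungaleCastellaSkinner2025

/-! ## §Z (v2). PROVED: the degenerate frame — why `Ω ≠ 0` must be a binder of every `∀`-fact over frames -/

namespace Literature.NumberTheory.EllipticCurves

section Degenerate

variable {K : Type} [Field K] [NumberField K] {p : ℕ} [Fact p.Prime]

/-- The zero series has the value `0` at every point. [cite: deShalit1987, II.4.17 (54) (G(χ; T₁, T₂))] -/
theorem IntSeries.hasValueAt₂_zero (x y : ℂ_[p]) : IntSeries.HasValueAt₂ (0 : PowerSeries (PowerSeries
    (PadicComplexInt p))) x y 0 := by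
  simp [IntSeries.HasValueAt₂]

/-- The zero series has ONLY the value `0`. [cite: deShalit1987, II.4.17 (54) (G(χ; T₁, T₂))] -/
theorem IntSeries.eq_zero_of_hasValueAt₂_zero {x y val : ℂ_[p]}
    (h : IntSeries.HasValueAt₂ (0 : PowerSeries (PowerSeries (PadicComplexInt p))) x y val) : val = 0 :=
  h.unique (IntSeries.hasValueAt₂_zero x y)

omit [Fact p.Prime] in
/-- With the period `Ω = 0` de Shalit's interpolation value (50) is `0` on the whole Katz range
`0 ≤ j < m` (the factor `Ω^{−(m+j)}` with `m + j ≥ 1`; Lean's `0⁻¹ = 0`).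
[cite: deShalit1987, II.4.16 (49)–(50) (Ω ∈ ℂˣ a CM period; the formula read at Ω = 0)] -/
theorem DeShalit1987.interpolationValue_eq_zero_of_period_eq_zero (v vbar : HeightOneSpectrum (𝓞 K))
    (S : Finset (HeightOneSpectrum (𝓞 K))) (ε : HeckeCharacter K) {m j : ℕ} (hjm : j < m)
    (δ Lval : ℂ) : DeShalit1987.interpolationValue p v vbar S ε m j 0 δ Lval = 0 := by
  have hmj : m + j ≠ 0 := by omega
  simp [DeShalit1987.interpolationValue, zero_pow hmj]

/-- **The degenerate Katz frame**: with `Ω = 0` the zero series satisfies `IsKatzMeasure₂` (every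
prescribed value is `0`). So `IsKatzMeasure₂ … Ω …` pins Katz's measure only together with `Ω ≠ 0`,
which every `∃`-fact of the tree supplies and every `∀`-fact must assume.
[cite: deShalit1987, II.4.16 (49)–(50), II.4.17 (54) (the frame; Ω ∈ ℂˣ there)] -/
theorem isKatzMeasure₂_zero_of_period_eq_zero (ι : PadicAlgCl p ≃+* ℂ)
    (v vbar : HeightOneSpectrum (𝓞 K)) (S : Finset (HeightOneSpectrum (𝓞 K)))
    (κ₁ κ₂ : ZpExtension K p) (g₁ g₂ : absoluteGaloisGroup K) (lam : HeckeCharacter K) (δ : ℂ)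
    (Ωp : ℂ_[p]) : IsKatzMeasure₂ ι v vbar S κ₁ κ₂ g₁ g₂ lam 0 δ Ωp 0 := by
  intro ρ r m j _ _ hjm _ _ hL
  have h0 : (((ι.symm (DeShalit1987.interpolationValue p v vbar S (lam * ρ) m j 0 δ
      (hL.continuation 0)) : PadicAlgCl p) : ℂ_[p]) * Ωp ^ (m + j)) = 0 := by
    rw [DeShalit1987.interpolationValue_eq_zero_of_period_eq_zero v vbar S (lam * ρ) hjm, map_zero]
    simp
  rw [h0]
  exact IntSeries.hasValueAt₂_zero _ _

/-- **The degenerate Greenberg frame**: over the Katz series `LK = 0` the zero series satisfies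
`IsGreenbergLFunctionAnyRoot₂` (the Katz value `y` in the prescribed product `h_K · y · (…)` is forced
to be `0`). Hence `∀`-statements over Katz/Greenberg frames must carry `Ω ≠ 0`. (Same term as the
Summits-side `SignedBaseChangeK1ZeroFrame.isGreenbergLFunctionAnyRoot₂_zero_zero`, which a Literature
file cannot import.)
[cite: YanZhu2024MainConjNonCM, Def. 3.11 with Thm. 3.9 (arXiv:2412.20078v4 TeX l.839–871) (the frame)] -/
theorem isGreenbergLFunctionAnyRoot₂_zero_zero (ι : PadicAlgCl p ≃+* ℂ)
    (v vbar : HeightOneSpectrum (𝓞 K)) (κ₁ κ₂ : ZpExtension K p) (g₁ g₂ : absoluteGaloisGroup K)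
    {N : ℕ} (f : CuspForm (Gamma0 N) 2) (D : ℕ) [NeZero D] (hK : ℕ) :
    IsGreenbergLFunctionAnyRoot₂ ι v vbar κ₁ κ₂ g₁ g₂ f D hK 0 0 := by
  intro ξ r m n α _ _ _ _ _ θ _ L _ _ y hy
  rw [IntSeries.eq_zero_of_hasValueAt₂_zero hy, mul_zero, zero_mul]
  exact IntSeries.hasValueAt₂_zero _ _

/-- … and `minus 0 = 0` has no unit coefficient: the conclusion of the `L_p^Gr`-half facts FAILS at the
degenerate frame. [cite: GreenbergVatsal2000, p. 2, (1)–(2) (μ = 0 ⟺ a unit coefficient)] -/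
theorem not_hasUnitContent_minus_zero :
    ¬ HasUnitContent (minus (0 : PowerSeries (PowerSeries (PadicComplexInt p)))) := by
  rintro ⟨k, hk⟩
  rw [coeff_minus] at hk
  simp at hk

end Degenerate

end Literature.NumberTheory.EllipticCurves

namespace Literature.NumberTheory.EllipticCurves.BurungaleCastellaSkinner2025

open YanZhu2026

/-! ## §A′ (v2). PROVED: the v1 fact is contradicted on every instance of its hypotheses -/

section Located

variable {p : ℕ} [Fact p.Prime]

/-- **LOCATED DEFECT (kernel-checked).** The unguarded v1 fact `prop422_grHalf_hasUnitContent_minus`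
yields `False` from ANY data satisfying its curve/field/tower hypotheses (and a unit `Ω_p`, e.g. `1`):
instantiate its frame binders at the degenerate frame `(Ω, δ, LK, G) = (0, 0, 0, 0)` (§Z). Nothing is
asserted about curves: the tree cannot construct such data, so no closed contradiction follows — but
every route hypothesis `(h : prop422_grHalf_…)` is refuted by the route's own setting.
[cite: BurungaleCastellaSkinner2025, Prop. 4.2.2 (§4.2, p. 9 of arXiv:2405.00270v2) (the intended statement, about Katz's measure with Ω ∈ ℂˣ)]
[cite: deShalit1987, II.4.12, II.4.16 (49)–(50) (Ω ≠ 0)] -/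
theorem prop422_grHalf_hasUnitContent_minus.false_of_instance (h : prop422_grHalf_hasUnitContent_minus)
    (ι : PadicAlgCl p ≃+* ℂ) (W : WeierstrassCurve ℚ) [W.IsElliptic] [W.IsGloballyMinimal] (K : Type)
    [Field K] [NumberField K] (v vbar : HeightOneSpectrum (𝓞 K)) (κ₁ κ₂ : ZpExtension K p)
    (γ₁ γ₂ : absoluteGaloisGroup K) [Fact (ZpExtension.IsTopGeneratorPair κ₁ κ₂ γ₁ γ₂)]
    {N : ℕ} [NeZero N] {f : CuspForm (Gamma0 N) 2} (hf : IsNewformOf W f)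
    [NeZero (NumberField.discr K).natAbs]
    (hN : (N : ℤ) = W.conductorNorm ℤ) (hp : 2 < p) (hgood : W.HasGoodReductionAtPrime p)
    (hK : IsImaginaryQuadratic K) (hHeeg : SatisfiesHeegnerHypothesis N K)
    (hspl : ((Ideal.span {(p : ℤ)}).primesOver (𝓞 K)).ncard = 2)
    (hodd : Odd (NumberField.discr K)) (hne3 : NumberField.discr K ≠ -3)
    (hcop : IsCoprime (N : ℤ) (NumberField.discr K))
    (hirrK : (W.baseChange K).HasIrreducibleModPGaloisRep p)
    (hv : ((p : ℕ) : 𝓞 K) ∈ v.asIdeal) (hvbar : ((p : ℕ) : 𝓞 K) ∈ vbar.asIdeal) (hne : vbar ≠ v)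
    (hcompat : ∀ (w : InfinitePlace K) (k : 𝓞 K), k ∈ v.asIdeal ↔ ‖ι.symm (w.embedding (k : K))‖ < 1)
    (hcyc : κ₁.IsCyclotomic) (hanti : κ₂.IsAnticyclotomic) (Ωp : (unrIntegers p)ˣ) : False :=
  not_hasUnitContent_minus_zero
    (h ι W K v vbar κ₁ κ₂ γ₁ γ₂ hf hN hp hgood hK hHeeg hspl hodd hne3 hcop hirrK hv hvbar hne hcompat hcyc
      hanti 0 0 Ωp 0 0 (isKatzMeasure₂_zero_of_period_eq_zero ι v vbar ∅ κ₁ κ₂ γ₁⁻¹ γ₂⁻¹ 1 0 _)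
      (isGreenbergLFunctionAnyRoot₂_zero_zero ι v vbar κ₁ κ₂ γ₁⁻¹ γ₂⁻¹ f _ _))

end Located

/-! ## §B′ (v2). The GUARDED named fact (BCS 2025, Prop. 4.2.2, `L_p^Gr` half, good reduction) -/

section Facts

/-- **Burungale–Castella–Skinner 2025, Proposition 4.2.2 (§4.2, p. 9), the `L_p^Gr` half, at a prime
of GOOD reduction `p > 2` — GUARDED re-vendoring** of `prop422_grHalf_hasUnitContent_minus` (v1,
mis-stated: module docstring §v2). Print: "Let `g ∈ S₂(Γ₀(N))` be an elliptic newform with good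
reduction at `p > 2`, and suppose `K` is an imaginary quadratic field satisfying (disc), (Heeg), (spl),
and (irr_K). Then `μ(L_p^Gr(g/K)) = μ(L_p^BDP(g/K)) = 0`", proof: "[Hsi14, Thm. B] … the projection
of `L_p^Gr(g/K)` to `Λ_K^{−,ur}` generates the same ideal as `L_p^BDP(g/K)` (see [CGS23, Prop.
1.4.5])". Transcribed in the reading the proof establishes (`μ` of the anticyclotomic projection
vanishes): for `E = W/ℚ` elliptic, globally minimal, with newform `f` of level `N = N_E`, `2 < p`,
`W.HasGoodReductionAtPrime p` (NO ordinarity), `K` imaginary quadratic with (Heeg), (spl) (`v, v̄ ∋ p`,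
`v̄ ≠ v`, `v` induced by `ι`), (disc), `(N, D_K) = 1`, (irr_K); `(κ₁, κ₂)` THE cyclotomic /
anticyclotomic `ℤ_p`-extensions with an adapted generator pair `(γ₁, γ₂)`: EVERY Katz frame with
GENUINE period data — `Ω ≠ 0`, `δ² = ±D_K`, `Ω_p ∈ R₀ˣ`, `IsKatzMeasure₂ ι v v̄ ∅ κ₁ κ₂ γ₁⁻¹ γ₂⁻¹ 1 Ω δ Ω_p LK`
— and EVERY `G` with `IsGreenbergLFunctionAnyRoot₂ ι v v̄ κ₁ κ₂ γ₁⁻¹ γ₂⁻¹ f |D_K| h_K LK G` (print's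
`L_p^Gr(g/K)`, continuation-bound any-root frame at the inverse generators) has
`HasUnitContent (minus G)`: some coefficient of `G⁻ = G(0, T₂)` is a unit of `𝒪_{ℂ_p}`. `Ω ≠ 0` is
necessary (§Z, §A′); the period binders are exactly those of the frame-supplying `∃`-facts; unit content
is orientation-robust (module docstring). WEAKER than print: `g = f_E`; `(N, D_K) = 1` assumed
(standing in [CGS23], where `L_p^Gr` is constructed; printed in BCS Thm. 4.1.3); coefficients `𝒪_{ℂ_p}`.
-- TODO(general form): `g` a weight-two newform with arbitrary Hecke field.
[cite: BurungaleCastellaSkinner2025, Prop. 4.2.2 and its proof (§4.2, p. 9 L2–L13 of arXiv:2405.00270v2), with §1.2 (disc)/(Heeg)/(spl) (p. 2 L34–L39), §4 (irr_K) and L_p^Gr via [CGS23, §1.4] (p. 7 L52–L59), Conj. 4.1.2 (p. 8 L15–L19)]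
[cite: Hsieh2014, Thm. B (μ(L_p^BDP) = 0, as cited by BCS)]
[cite: CastellaGrossiSkinner2025, Def. 2.4.3, Prop. 2.4.5 (= CGS23 Def. 1.4.3, Prop. 1.4.5: the object and the comparison, as cited by BCS)]
[cite: deShalit1987, II.4.12, II.4.16 (49)–(50) (the period pair (Ω, Ω_p), Ω ∈ ℂˣ, δ = √(±d_K))] -/
def prop422_greenbergAnyRoot_hasUnitContent_minus : Prop :=
  ∀ {p : ℕ} [Fact p.Prime] (ι : PadicAlgCl p ≃+* ℂ) (W : WeierstrassCurve ℚ) [W.IsElliptic]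
    [W.IsGloballyMinimal] (K : Type) [Field K] [NumberField K] (v vbar : HeightOneSpectrum (𝓞 K))
    (κ₁ κ₂ : ZpExtension K p) (γ₁ γ₂ : absoluteGaloisGroup K)
    [Fact (ZpExtension.IsTopGeneratorPair κ₁ κ₂ γ₁ γ₂)] {N : ℕ} [NeZero N]
    {f : CuspForm (Gamma0 N) 2} (_ : IsNewformOf W f) [NeZero (NumberField.discr K).natAbs],
    -- `g = f_E` of level `N = N_E`; `p > 2` of GOOD reduction
    (N : ℤ) = W.conductorNorm ℤ → 2 < p → W.HasGoodReductionAtPrime p →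
    -- `K` imaginary quadratic; (Heeg); (spl); (disc); `(N, D_K) = 1`; (irr_K)
    IsImaginaryQuadratic K → SatisfiesHeegnerHypothesis N K →
    ((Ideal.span {(p : ℤ)}).primesOver (𝓞 K)).ncard = 2 →
    Odd (NumberField.discr K) → NumberField.discr K ≠ -3 → IsCoprime (N : ℤ) (NumberField.discr K) →
    (W.baseChange K).HasIrreducibleModPGaloisRep p →
    -- `v, v̄` the two primes above `p`, `v` the one induced by `ι`
    ((p : ℕ) : 𝓞 K) ∈ v.asIdeal → ((p : ℕ) : 𝓞 K) ∈ vbar.asIdeal → vbar ≠ v →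
    (∀ (w : InfinitePlace K) (k : 𝓞 K), k ∈ v.asIdeal ↔ ‖ι.symm (w.embedding (k : K))‖ < 1) →
    -- the `ℤ_p²`-tower in (cyclotomic, anticyclotomic) coordinates
    κ₁.IsCyclotomic → κ₂.IsAnticyclotomic →
    -- every Katz frame with GENUINE period data, and every Greenberg frame over it
    ∀ (Ω δ : ℂ) (Ωp : (unrIntegers p)ˣ) (LK G : PowerSeries (PowerSeries (PadicComplexInt p))),
      Ω ≠ 0 → (δ ^ 2 = (NumberField.discr K : ℂ) ∨ δ ^ 2 = -(NumberField.discr K : ℂ)) →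
      IsKatzMeasure₂ ι v vbar ∅ κ₁ κ₂ γ₁⁻¹ γ₂⁻¹ 1 Ω δ ((Ωp : unrIntegers p) : ℂ_[p]) LK →
      IsGreenbergLFunctionAnyRoot₂ ι v vbar κ₁ κ₂ γ₁⁻¹ γ₂⁻¹ f (NumberField.discr K).natAbs
        (NumberField.classNumber K) LK G →
      HasUnitContent (minus G)

end Facts

/-! ## §C′ (v2). PROVED: ports of the guarded fact -/

section API

variable {p : ℕ} [Fact p.Prime]

/-- The guarded fact is WEAKER than the v1 statement (two extra hypotheses): `v1 → v2`. (Recorded so that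
nothing proved from v1 is lost by switching; the converse fails, §A′.)
[cite: BurungaleCastellaSkinner2025, Prop. 4.2.2 (§4.2, p. 9 of arXiv:2405.00270v2)] -/
theorem prop422_greenbergAnyRoot_hasUnitContent_minus.of_grHalf
    (h : prop422_grHalf_hasUnitContent_minus) : prop422_greenbergAnyRoot_hasUnitContent_minus :=
  fun ι W _ _ K _ _ v vbar κ₁ κ₂ γ₁ γ₂ _ _ _ _ hf _ hN hp hgood hK hHeeg hspl hodd hne3 hcop hirrK hv hvbar
      hne hcompat hcyc hanti Ω δ Ωp LK G _ _ hLK hG ↦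
    h ι W K v vbar κ₁ κ₂ γ₁ γ₂ hf hN hp hgood hK hHeeg hspl hodd hne3 hcop hirrK hv hvbar hne hcompat hcyc
      hanti Ω δ Ωp LK G hLK hG

/-- **`μ(L_p^Gr(E/K)) = 0` in the two-variable sense, at good reduction** — granted the guarded fact:
under its hypotheses some coefficient `[T₁⁰ T₂ʲ] G` of the Greenberg series `G ∈ 𝒪_{ℂ_p}⟦T₁⟧⟦T₂⟧` is a
unit of `𝒪_{ℂ_p}` (the displayed conclusion of Prop. 4.2.2).
[cite: BurungaleCastellaSkinner2025, Prop. 4.2.2 (§4.2, p. 9 L2–L5 of arXiv:2405.00270v2)] -/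
theorem exists_isUnit_coeff_coeff_of_prop422GrAnyRoot
    (h : prop422_greenbergAnyRoot_hasUnitContent_minus) (ι : PadicAlgCl p ≃+* ℂ)
    (W : WeierstrassCurve ℚ) [W.IsElliptic] [W.IsGloballyMinimal] (K : Type) [Field K] [NumberField K]
    (v vbar : HeightOneSpectrum (𝓞 K)) (κ₁ κ₂ : ZpExtension K p) (γ₁ γ₂ : absoluteGaloisGroup K)
    [Fact (ZpExtension.IsTopGeneratorPair κ₁ κ₂ γ₁ γ₂)] {N : ℕ} [NeZero N]
    {f : CuspForm (Gamma0 N) 2} (hf : IsNewformOf W f) [NeZero (NumberField.discr K).natAbs]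
    (hN : (N : ℤ) = W.conductorNorm ℤ) (hp : 2 < p) (hgood : W.HasGoodReductionAtPrime p)
    (hK : IsImaginaryQuadratic K) (hHeeg : SatisfiesHeegnerHypothesis N K)
    (hspl : ((Ideal.span {(p : ℤ)}).primesOver (𝓞 K)).ncard = 2) (hodd : Odd (NumberField.discr K))
    (h3 : NumberField.discr K ≠ -3) (hcop : IsCoprime (N : ℤ) (NumberField.discr K))
    (hirrK : (W.baseChange K).HasIrreducibleModPGaloisRep p) (hv : ((p : ℕ) : 𝓞 K) ∈ v.asIdeal)
    (hvbar : ((p : ℕ) : 𝓞 K) ∈ vbar.asIdeal) (hne : vbar ≠ v)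
    (hι : ∀ (w : InfinitePlace K) (k : 𝓞 K), k ∈ v.asIdeal ↔ ‖ι.symm (w.embedding (k : K))‖ < 1)
    (hcyc : κ₁.IsCyclotomic) (hanti : κ₂.IsAnticyclotomic) {Ω δ : ℂ} {Ωp : (unrIntegers p)ˣ}
    {LK G : PowerSeries (PowerSeries (PadicComplexInt p))} (hΩ : Ω ≠ 0)
    (hδ : δ ^ 2 = (NumberField.discr K : ℂ) ∨ δ ^ 2 = -(NumberField.discr K : ℂ))
    (hLK : IsKatzMeasure₂ ι v vbar ∅ κ₁ κ₂ γ₁⁻¹ γ₂⁻¹ 1 Ω δ ((Ωp : unrIntegers p) : ℂ_[p]) LK)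
    (hG : IsGreenbergLFunctionAnyRoot₂ ι v vbar κ₁ κ₂ γ₁⁻¹ γ₂⁻¹ f (NumberField.discr K).natAbs
      (NumberField.classNumber K) LK G) :
    ∃ j : ℕ, IsUnit (PowerSeries.coeff j (PowerSeries.coeff 0 G)) := by
  obtain ⟨j, hj⟩ := h ι W K v vbar κ₁ κ₂ γ₁ γ₂ hf hN hp hgood hK hHeeg hspl hodd h3 hcop hirrK hv hvbar
    hne hι hcyc hanti Ω δ Ωp LK G hΩ hδ hLK hG
  exact ⟨j, by rwa [coeff_minus] at hj⟩

/-- **The ordinary special case, in the currency of `YanZhu2026.GreenbergSetting`**: granted the guarded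
fact, every Katz/Greenberg frame with genuine period data under `GreenbergSetting`, (Heeg), (irr_K) has
`HasUnitContent (G⁻)` — the conclusion `GreenbergMuInvariantProofs.lean` derives there from the two
ordinary-typed facts (`hasUnitContent_minus_of_prop314AnyRoot_of_prop422`); the guarded fact extends it
to supersingular `p`. [cite: BurungaleCastellaSkinner2025, Prop. 4.2.2 and its proof (§4.2, p. 9 L2–L13 of arXiv:2405.00270v2)]
[cite: YanZhu2024MainConjNonCM, §4.1 setting (arXiv:2412.20078v4 TeX l.909–915) (`GreenbergSetting`)] -/
theorem hasUnitContent_minus_of_prop422GrAnyRoot_of_greenbergSetting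
    (h : prop422_greenbergAnyRoot_hasUnitContent_minus) (ι : PadicAlgCl p ≃+* ℂ)
    (W : WeierstrassCurve ℚ) [W.IsElliptic] [W.IsGloballyMinimal] (K : Type) [Field K] [NumberField K]
    (v vbar : HeightOneSpectrum (𝓞 K)) (κ₁ κ₂ : ZpExtension K p) (γ₁ γ₂ : absoluteGaloisGroup K)
    [Fact (ZpExtension.IsTopGeneratorPair κ₁ κ₂ γ₁ γ₂)] {N : ℕ} [NeZero N]
    {f : CuspForm (Gamma0 N) 2} (hf : IsNewformOf W f) [NeZero (NumberField.discr K).natAbs]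
    (hS : GreenbergSetting ι W N K v vbar κ₁ κ₂) (hHeeg : SatisfiesHeegnerHypothesis N K)
    (hirrK : (W.baseChange K).HasIrreducibleModPGaloisRep p) {Ω δ : ℂ} {Ωp : (unrIntegers p)ˣ}
    {LK G : PowerSeries (PowerSeries (PadicComplexInt p))} (hΩ : Ω ≠ 0)
    (hδ : δ ^ 2 = (NumberField.discr K : ℂ) ∨ δ ^ 2 = -(NumberField.discr K : ℂ))
    (hLK : IsKatzMeasure₂ ι v vbar ∅ κ₁ κ₂ γ₁⁻¹ γ₂⁻¹ 1 Ω δ ((Ωp : unrIntegers p) : ℂ_[p]) LK)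
    (hG : IsGreenbergLFunctionAnyRoot₂ ι v vbar κ₁ κ₂ γ₁⁻¹ γ₂⁻¹ f (NumberField.discr K).natAbs
      (NumberField.classNumber K) LK G) :
    HasUnitContent (minus G) :=
  h ι W K v vbar κ₁ κ₂ γ₁ γ₂ hf hS.level (by have := hS.three_le; omega) hS.goodOrd.1
    hS.isImaginaryQuadratic hHeeg hS.split hS.discr_odd hS.discr_ne hS.coprime hirrK hS.mem_v
    hS.mem_vbar hS.vbar_ne hS.compat hS.cyclotomic hS.anticyclotomic Ω δ Ωp LK G hΩ hδ hLK hG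

/-- **Both halves of Prop. 4.2.2 at good reduction, existential form** — granted the guarded fact, the
reduction-type-free BDP half `prop422_exists_isBDPLFunction_mu_eq_zero`, and ANY supplier of a
Katz/Greenberg frame with genuine period data (e.g. the supersingular existence fact
`BurungaleSkinnerTianWan2024.thm617_…_supersingular_PRE`, or the ordinary
`YanZhu2026.thm39_…AnyRoot₂`, passed as the hypothesis `hfr`): there ARE a frame `(LK, G)` with
`μ(G⁻) = 0` and a BDP frame `L` at the anticyclotomic generator `γ₂` with `μ(L) = 0`.
[cite: BurungaleCastellaSkinner2025, Prop. 4.2.2 (§4.2, p. 9 L2–L13 of arXiv:2405.00270v2)]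
[cite: Hsieh2014, Thm. B] -/
theorem prop422_both_goodReduction_of_frame
    (h : prop422_greenbergAnyRoot_hasUnitContent_minus) (h422 : prop422_exists_isBDPLFunction_mu_eq_zero)
    (ι : PadicAlgCl p ≃+* ℂ) (W : WeierstrassCurve ℚ) [W.IsElliptic] [W.IsGloballyMinimal] (K : Type)
    [Field K] [NumberField K] (v vbar : HeightOneSpectrum (𝓞 K)) (κ₁ κ₂ : ZpExtension K p)
    (γ₁ γ₂ : absoluteGaloisGroup K) [hpair : Fact (ZpExtension.IsTopGeneratorPair κ₁ κ₂ γ₁ γ₂)]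
    {N : ℕ} [NeZero N] {f : CuspForm (Gamma0 N) 2} (hf : IsNewformOf W f)
    [NeZero (NumberField.discr K).natAbs] (hN : (N : ℤ) = W.conductorNorm ℤ) (hp : 2 < p)
    (hgood : W.HasGoodReductionAtPrime p) (hK : IsImaginaryQuadratic K)
    (hHeeg : SatisfiesHeegnerHypothesis N K) (hspl : ((Ideal.span {(p : ℤ)}).primesOver (𝓞 K)).ncard = 2)
    (hodd : Odd (NumberField.discr K)) (h3 : NumberField.discr K ≠ -3)
    (hcop : IsCoprime (N : ℤ) (NumberField.discr K)) (hirrK : (W.baseChange K).HasIrreducibleModPGaloisRep p)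
    (hv : ((p : ℕ) : 𝓞 K) ∈ v.asIdeal) (hvbar : ((p : ℕ) : 𝓞 K) ∈ vbar.asIdeal) (hne : vbar ≠ v)
    (hι : ∀ (w : InfinitePlace K) (k : 𝓞 K), k ∈ v.asIdeal ↔ ‖ι.symm (w.embedding (k : K))‖ < 1)
    (hcyc : κ₁.IsCyclotomic) (hanti : κ₂.IsAnticyclotomic)
    (hfr : ∃ (Ω δ : ℂ) (Ωp : (unrIntegers p)ˣ) (LK G : PowerSeries (PowerSeries (PadicComplexInt p))),
      Ω ≠ 0 ∧ (δ ^ 2 = (NumberField.discr K : ℂ) ∨ δ ^ 2 = -(NumberField.discr K : ℂ)) ∧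
      IsKatzMeasure₂ ι v vbar ∅ κ₁ κ₂ γ₁⁻¹ γ₂⁻¹ 1 Ω δ ((Ωp : unrIntegers p) : ℂ_[p]) LK ∧
      IsGreenbergLFunctionAnyRoot₂ ι v vbar κ₁ κ₂ γ₁⁻¹ γ₂⁻¹ f (NumberField.discr K).natAbs
        (NumberField.classNumber K) LK G) :
    (∃ (Ω δ : ℂ) (Ωp : (unrIntegers p)ˣ) (LK G : PowerSeries (PowerSeries (PadicComplexInt p))),
        Ω ≠ 0 ∧ (δ ^ 2 = (NumberField.discr K : ℂ) ∨ δ ^ 2 = -(NumberField.discr K : ℂ)) ∧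
        IsKatzMeasure₂ ι v vbar ∅ κ₁ κ₂ γ₁⁻¹ γ₂⁻¹ 1 Ω δ ((Ωp : unrIntegers p) : ℂ_[p]) LK ∧
        IsGreenbergLFunctionAnyRoot₂ ι v vbar κ₁ κ₂ γ₁⁻¹ γ₂⁻¹ f (NumberField.discr K).natAbs
          (NumberField.classNumber K) LK G ∧ HasUnitContent (minus G)) ∧
      ∃ (ΩK : ℂ) (Ωp' : (unrIntegers p)ˣ) (L : UnrSeries p), ΩK ≠ 0 ∧
        IsBDPLFunction ι v κ₂ γ₂ f ΩK ((Ωp' : unrIntegers p) : ℂ_[p]) L ∧ HasUnitContent L := by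
  refine ⟨?_, ?_⟩
  · obtain ⟨Ω, δ, Ωp, LK, G, hΩ, hδ, hLK, hG⟩ := hfr
    exact ⟨Ω, δ, Ωp, LK, G, hΩ, hδ, hLK, hG, h ι W K v vbar κ₁ κ₂ γ₁ γ₂ hf hN hp hgood hK hHeeg hspl
      hodd h3 hcop hirrK hv hvbar hne hι hcyc hanti Ω δ Ωp LK G hΩ hδ hLK hG⟩
  · obtain ⟨ΩK, Ωp', L, hΩK, hBDP, k, hk⟩ := h422 ι W K v κ₂ γ₂ hf hp hgood hK hHeeg hspl hodd h3
      hirrK hv hι hanti hpair.out.right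
    exact ⟨ΩK, Ωp', L, hΩK, hBDP, k, hk⟩

end API

end Literature.NumberTheory.EllipticCurves.BurungaleCastellaSkinner2025

end
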